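import Mathlib.Analysis.Asymptotics.ExpGrowth
import Mathlib.Analysis.SpecialFunctions.Pow.NNReal
import Mathlib.Analysis.Calculus.FDeriv.Basic
import Mathlib.MeasureTheory.Integral.Lebesgue.Basic
import Mathlib.LinearAlgebra.Dimension.Finrank
import Literature.Analysis.FluidPDE.HardSphereDynamics
import Literature.Analysis.FluidPDE.InfiniteHardSphereDynamics
import Literature.Dynamics.Ergodic.KolmogorovSinaiEntropy
import HarnessLib

/-!
# Space-time entropy, positive Lyapunov exponents and the Pesin defect of hard-sphere systems

Topic `Literature/Dynamics/Billiards`; definition request `defn-PesinDefectDensity` of route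
`Summits/AtomisticToContinuum/HydrodynamicLimit/Theses/PesinPricing.lean` (cruxes `KiferYoungUpper`,
`PesinSaturationRigidity`; crux `EntropyPerParticle` writes the entropy rate of a partition inline in
the cell-wise form of `partitionEntropy_itinerary_eq_sum` below).

## Content

1. **Kolmogorov–Sinai entropy** is REUSED from `Literature.Dynamics.Ergodic.KolmogorovSinaiEntropy`
   (Walters 1982 Ch. 4, same representation as here: a finite measurable partition is a labelled
   partition, i.e. a finite-valued observable `ξ : Ω → α`, `Fintype α`): `partitionEntropy μ ξ =
   H_μ(ξ)` (Def. 4.6), the join `itinerary T ξ n = ⋁_{i<n} T^{-i} ξ` (§4.4), `dynEntropy μ T ξ =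
   h_μ(T, ξ)` (Def. 4.9, as the infimum = limit, Thm. 4.10) and `kolmogorovSinaiEntropy μ T = h_μ(T)
   ∈ [0, ∞]` (Def. 4.10). Nothing of it is restated; this file only adds the bridge
   `partitionEntropy_itinerary_eq_sum` to the cell-wise expression written inline by crux
   `EntropyPerParticle`.
2. **Entropy of a space-time (`ℤ^{1+d}`-) action** generated by a time map `T` and commuting space
   shifts `S k`, `k ∈ ℤ^d` (NEW, built on `partitionEntropy` / `itinerary`): `spatialJoin S ξ L =
   ⋁_{k ∈ [0,L)^d} S_k^{-1} ξ`, `spaceTimeJoin T S ξ n L = ⋁_{(m,k) ∈ [0,n)×[0,L)^d} (S_k T^m)^{-1} ξ`,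
   `spaceTimeEntropyRate μ T S ξ = inf over boxes of H_μ(ξ^{box}) / (n L^d)` (Keller 1998
   Thm. 3.2.4: for an invariant `μ` the limit along cubes exists and equals the infimum;
   Exercise 3.2.10: also along rectangles), and `spaceTimeEntropy μ T S = sup_ξ` (Keller
   Def. 3.2.11) — entropy per unit time per unit volume of the JOINT action. (A different object
   with a similar name: `Literature.MathematicalPhysics.KineticTheory.spaceTimeEntropyDensity` of
   the oscillator CHAIN takes, for a fixed single-site partition, the TIME entropy
   `h_ν(φ₁, ξ_{window})` first, divides by the window length and lets the window grow (`limsup`),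
   then the `sup` over single-site partitions — a `ℤ¹`-specific, time-first order of limits; the two
   agree for doubly invariant laws by subadditivity, not formalised there or here.)
3. **Lyapunov exponents of a linear cocycle** `A : ℕ → V →L[ℝ] V` (the derivative cocycle
   `A n = D(f^n)(x)` at one point): the forward (upper) Lyapunov exponent
   `lyapExponent A v = limsup_n n⁻¹ log ‖A n v‖ ∈ [-∞, ∞]` (Barreira–Pesin 2023 §3.2, with
   `log 0 = -∞`; this is Mathlib's `ExpGrowth.expGrowthSup` of `n ↦ ‖A n v‖ₑ`), the filtration
   subspaces `lyapFiltration A c = {v | χ(v) ≤ c}` (PROVED to be subspaces, Barreira–Pesin §2.1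
   (2.1) and Thm. 2.2), and the **sum of the positive Lyapunov exponents counted with multiplicity**
   `posLyapSum A = ∑_{χ_i > 0} k_i χ_i = ∫₀^∞ (dim V - dim V_c) dc ∈ [0, ∞]` (multiplicities
   `k_i = dim V_i - dim V_{i-1}`, Barreira–Pesin §2.1.2; the layer-cake identity
   `∑_j max(χ^{(j)}, 0) = ∫₀^∞ #{j : χ^{(j)} > c} dc` turns the spectrum into the counting function
   `c ↦ dim V - dim V_c`, so no ordering/Oseledets input is needed to STATE it; `+∞` if some vector has
   exponent `+∞`). This is the integrand of the Margulis–Ruelle inequality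
   `h_ν(f) ≤ ∫ ∑_{χ_i(x) > 0} k_i(x) χ_i(x) dν` (Barreira–Pesin Thm. 9.22).
4. **Finite hard-sphere systems** (`Literature.Analysis.FluidPDE.HardSphereFlow G ε N`, `N` spheres of
   diameter `ε` in the geometry `G`, torus or whole space): the tangent space `TangentCfg N d =
   (ℝ^d × ℝ^d)^N`, the charts `perturb G z` / `displacement G z` given by the geometry's translation
   and separation maps, the derivative `tangentMapWithin G F S z` of a phase-space map `F` at `z` read in
   these charts and taken WITHIN a set `S` (`fderivWithin`), the derivative cocycle of the flow
   `tangentFlow Φ n z = D(Φ_n)(z)` within the good set (the flow is unspecified off `Φ.good`, so the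
   plain `fderiv` would see junk; `Φ.good` is Liouville-conull hence dense in every ball, which makes
   the derivative within it unique, and on it `Φ_n` is the composition of free flights `freeFlight` and
   elastic collisions `collidePair` along the orbit, `HardSphereFlow.isTrajectory`), the exponents
   `flowLyapExponent Φ z v`, `posLyapSumAt Φ z = ∑λ⁺(z)`, `meanPosLyapSum Φ μ = ∫ ∑λ⁺ dμ`, the
   Kolmogorov–Sinai entropy of the time-one map `timeOneEntropy Φ μ = h_μ(Φ₁)`, the **Pesin defect**
   `pesinDefect Φ μ = ∫ ∑λ⁺ dμ - h_μ(Φ₁) ∈ [0, ∞]` and its per-collision normalisation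
   `pesinDefectPerCollision Φ μ = pesinDefect Φ μ / N^{4/3}` at the Euler scaling of the route
   (`N` spheres of diameter `σ N^{-1/3}` on `𝕋³` collide `≍ N^{4/3}` times per unit macroscopic time).
5. **The infinite hard-sphere gas** (`InfiniteHardSphereFlow d ε`, laws `ν` on
   `PointConfig (ℝ^d × ℝ^d)`): the lattice shifts `latticeShift k`, the **space-time entropy density**
   `entropyDensity Φ ν` = entropy per unit time per unit volume of the `ℤ^{1+d}`-action generated by
   the time-one map and the unit lattice translations (the entropy "with respect to the group of
   time-space translations" of Chernov–Sinai 1982, whose identification with the thermodynamic limit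
   `lim h(Φ¹)/N = h(ρ, E)` for small densities is quoted in Wojtkowski 1988, p. 133), and the
   **collision intensity** `collisionIntensity Φ ν` (expected number of collision events per unit time
   with position in the unit cube), the normaliser "per collision" of the route.

## Design choices and deviations from the request

* The request's literal formula for the entropy density — sup over partitions measurable with
  respect to a bounded window `W` of the TIME entropy `h_ν(Φ₁, 𝒫)/|W|`, then `W ↑ ℝ³` — is `+∞` for
  every window under any reasonable state of the infinite gas (particles entering `W` carry fresh
  continuously distributed data, so `sup_𝒫 h_ν(Φ₁, 𝒫) = ∞` already for fixed `W`); the finite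
  quantity the request means ("Sinai–Chernov 1982 entropy per unit time per unit volume") is the
  entropy of the space-time translation group, which is what `entropyDensity` is (taking instead,
  for a FIXED partition, the time entropy per window volume and the window limit before the `sup`,
  as the chain file of `KineticTheory` does in `d = 1`, is the other finite option). The supremum
  runs over all finite measurable partitions (Keller Def. 3.2.11), not only window-measurable ones.
* Infimum instead of limit in `spaceTimeEntropyRate` (equal for invariant laws, Keller Thm. 3.2.4,
  as for the tree's `dynEntropy`, Walters Thm. 4.10); `ℝ≥0∞`-valued `spaceTimeEntropy`,
  `posLyapSum`, `pesinDefect`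
  (truncated subtraction: the defect is `0` when `∫∑λ⁺ ≤ h`, and `∞ - ∞ = 0`; it is the honest
  difference whenever `h_μ(Φ₁) ≤ ∫∑λ⁺ dμ < ∞`, `timeOneEntropy_add_pesinDefect`).
* Lyapunov exponents along INTEGER times (the cocycle of the time-one map, Barreira–Pesin §3.2):
  at the (countably many) collision instants of an orbit the flow map is not differentiable and the
  chart derivative is the junk value `0`; integer times avoid them for Liouville-a.e. initial datum.
  Exponents do not depend on the (sup-) norm of `TangentCfg`.
* NOT HERE (no printed source states them for these objects; to be vendored by a cite pass once the
  sources are in hand, or filed as route items): the Margulis–Ruelle inequality and the Pesin entropy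
  formula for hard-ball flows (Katok–Strelcyn–Ledrappier–Przytycki 1986 Parts IV/V and Sinai–Chernov
  1987 carry hypotheses on the singularities that must be copied verbatim), the positive-Lyapunov
  density `λ⁺(ν)` and the defect `i(ν)` of the INFINITE gas (they need the local unstable plaques of
  the requested but not yet defined `URegularState`; no thermodynamic-limit-free definition is in
  print), and "`i` is affine and lower semicontinuous" (no source).

## References

* P. Walters, *An Introduction to Ergodic Theory* (1982), §4.4: Def. 4.9, Def. 4.10, Thm. 4.9,
  Cor. 4.9.1, Thm. 4.10.
* G. Keller, *Equilibrium States in Ergodic Theory* (1998), Def. 3.1.1, Thm. 3.2.4, Cor. 3.2.5,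
  Exercise 3.2.10, Def. 3.2.11.
* L. Barreira, Ya. Pesin, *Introduction to Smooth Ergodic Theory*, 2nd ed. (2023), §2.1 (filtrations,
  multiplicities, Thm. 2.2), §3.2 (`χ⁺(x, v) = limsup m⁻¹ log ‖𝒜(x, m) v‖`), Thm. 9.22, Thm. 9.27.
* M. Wojtkowski, *Measure theoretic entropy of the system of hard spheres*, ETDS 8 (1988), p. 133
  (quoting N. I. Chernov, Ya. G. Sinai, Trudy Sem. Petrovsk. 8 (1982) 218–238).
* F. Ledrappier, L.-S. Young, Ann. of Math. 122 (1985) (measures satisfying Pesin's entropy formula).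
-/

noncomputable section

open MeasureTheory Filter Set
open scoped ENNReal

namespace Literature.Dynamics.Billiards

/-! ## 1. Space-time refinements and the entropy of a space-time action
(on top of `Literature.Dynamics.Ergodic.KolmogorovSinaiEntropy`) -/

section Refinements

variable {Ω : Type*} {α : Type*} {ι : Type*}

/-- The **spatial refinement** of a labelled partition `ξ` over the lattice box `[0, L)^ι` under the
space shifts `S k`, `k ∈ ℤ^ι`: the observable `ω ↦ (k ↦ ξ (S k ω))`, i.e. the partition
`⋁_{k ∈ [0,L)^ι} S_k^{-1} ξ` (Keller 1998 §3.2, notation `α^Λ`, for the sub-box `{0} × [0, L)^ι`).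
[cite: Keller1998, §3.2 (notation α^Λ)] -/
def spatialJoin (S : (ι → ℤ) → Ω → Ω) (ξ : Ω → α) (L : ℕ) : Ω → (ι → Fin L) → α :=
  fun ω k => ξ (S (fun i => ((k i : ℕ) : ℤ)) ω)

/-- Unfolding lemma for `spatialJoin`. [folklore] -/
@[simp]
theorem spatialJoin_apply (S : (ι → ℤ) → Ω → Ω) (ξ : Ω → α) (L : ℕ) (ω : Ω) (k : ι → Fin L) :
    spatialJoin S ξ L ω k = ξ (S (fun i => ((k i : ℕ) : ℤ)) ω) :=
  rfl

/-- The **space-time refinement** of a labelled partition `ξ` over the box `[0, n) × [0, L)^ι` of the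
`ℤ^{1+ι}`-action generated by a time map `T` and space shifts `S k`, `k ∈ ℤ^ι`: the observable
`ω ↦ ((m, k) ↦ ξ (S k (T^m ω)))`, i.e. the partition `⋁_{g ∈ box} 𝒯^{-g} ξ` (Keller 1998 §3.2,
notation `α^Λ`) — the `itinerary` (`Literature.Dynamics.Ergodic.itinerary`, Walters §4.4) of the
spatial refinement under `T`. [cite: Keller1998, §3.2 (notation α^Λ)] -/
def spaceTimeJoin (T : Ω → Ω) (S : (ι → ℤ) → Ω → Ω) (ξ : Ω → α) (n L : ℕ) :
    Ω → Fin n → (ι → Fin L) → α :=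
  Ergodic.itinerary T (spatialJoin S ξ L) n

/-- Unfolding lemma for `spaceTimeJoin`. [folklore] -/
@[simp]
theorem spaceTimeJoin_apply (T : Ω → Ω) (S : (ι → ℤ) → Ω → Ω) (ξ : Ω → α) (n L : ℕ) (ω : Ω)
    (m : Fin n) (k : ι → Fin L) :
    spaceTimeJoin T S ξ n L ω m k = ξ (S (fun i => ((k i : ℕ) : ℤ)) (T^[m] ω)) :=
  rfl

/-- The spatial refinement of a measurable observable by measurable shifts is measurable.
[folklore] -/
theorem measurable_spatialJoin [MeasurableSpace Ω] [MeasurableSpace α] {S : (ι → ℤ) → Ω → Ω}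
    {ξ : Ω → α} (hS : ∀ k, Measurable (S k)) (hξ : Measurable ξ) (L : ℕ) :
    Measurable (spatialJoin S ξ L) :=
  measurable_pi_lambda _ fun _ => hξ.comp (hS _)

/-- The space-time refinement of a measurable observable by measurable maps is measurable.
[folklore] -/
theorem measurable_spaceTimeJoin [MeasurableSpace Ω] [MeasurableSpace α] {T : Ω → Ω}
    {S : (ι → ℤ) → Ω → Ω} {ξ : Ω → α} (hT : Measurable T) (hS : ∀ k, Measurable (S k))
    (hξ : Measurable ξ) (n L : ℕ) : Measurable (spaceTimeJoin T S ξ n L) :=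
  Ergodic.measurable_itinerary hT (measurable_spatialJoin hS hξ L) n

end Refinements

section Entropy

variable {Ω : Type*} [MeasurableSpace Ω] {α : Type*} [Fintype α]

/-- The entropy of the dynamical refinement `⋁_{i<n} T^{-i} ξ` (`Ergodic.itinerary`) written out on its
cells, `H_μ(ξ₀^{n-1}) = -∑_w μ(⋂_m T^{-m}{ξ = w m}) log μ(⋂_m T^{-m}{ξ = w m})` — the expression used
inline (with `liminf_n n⁻¹ ·`) by crux `EntropyPerParticle` of route `PesinPricing`; bridge to the
tree's `Ergodic.partitionEntropy` / `Ergodic.dynEntropy`. [folklore] -/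
theorem partitionEntropy_itinerary_eq_sum (μ : Measure Ω) (T : Ω → Ω) (ξ : Ω → α) (n : ℕ) :
    Ergodic.partitionEntropy μ (Ergodic.itinerary T ξ n) =
      ∑ w : Fin n → α, -(μ.real (⋂ m : Fin n, T^[m] ⁻¹' (ξ ⁻¹' {w m})) *
        Real.log (μ.real (⋂ m : Fin n, T^[m] ⁻¹' (ξ ⁻¹' {w m})))) := by
  simp only [Ergodic.partitionEntropy, Ergodic.preimage_itinerary_singleton, Real.negMulLog,
    neg_mul]

/-! ### Entropy of a space-time action -/

variable {ι : Type*} [Fintype ι] [DecidableEq ι]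

/-- The **space-time entropy of the partition `ξ`** (entropy per unit time per unit volume):
`inf` over boxes `[0, n) × [0, L)^ι`, `n, L ≥ 1`, of `H_μ(ξ^{box}) / (n L^{#ι})`
(`H_μ = Ergodic.partitionEntropy`). For a law invariant under the action this is the limit along
cubes (Keller 1998 Thm. 3.2.4, `h(α, 𝒯) := inf = lim`, with Cor. 3.2.5 for boxes in `ℤ^d_+`) and
along rectangles (Exercise 3.2.10). [cite: Keller1998, Thm. 3.2.4] -/
def spaceTimeEntropyRate (μ : Measure Ω) (T : Ω → Ω) (S : (ι → ℤ) → Ω → Ω) (ξ : Ω → α) : ℝ :=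
  ⨅ p : ℕ × ℕ, Ergodic.partitionEntropy μ (spaceTimeJoin T S ξ (p.1 + 1) (p.2 + 1)) /
    ((p.1 + 1 : ℝ) * (p.2 + 1 : ℝ) ^ Fintype.card ι)

/-- Unfolding lemma for `spaceTimeEntropyRate`. [folklore] -/
theorem spaceTimeEntropyRate_def (μ : Measure Ω) (T : Ω → Ω) (S : (ι → ℤ) → Ω → Ω) (ξ : Ω → α) :
    spaceTimeEntropyRate μ T S ξ =
      ⨅ p : ℕ × ℕ, Ergodic.partitionEntropy μ (spaceTimeJoin T S ξ (p.1 + 1) (p.2 + 1)) /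
        ((p.1 + 1 : ℝ) * (p.2 + 1 : ℝ) ^ Fintype.card ι) :=
  rfl

/-- `0 ≤` the space-time entropy of a partition. [folklore] -/
theorem spaceTimeEntropyRate_nonneg (μ : Measure Ω) [IsZeroOrProbabilityMeasure μ] (T : Ω → Ω)
    (S : (ι → ℤ) → Ω → Ω) (ξ : Ω → α) : 0 ≤ spaceTimeEntropyRate μ T S ξ :=
  Real.iInf_nonneg fun _ => div_nonneg (Ergodic.partitionEntropy_nonneg _) (by positivity)

/-- The space-time entropy of a partition is below each box term, in particular (box `1 × 1^ι`)
below the static entropy `H_μ(ξ^{1 × [0,1)^ι})`. [folklore] -/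
theorem spaceTimeEntropyRate_le (μ : Measure Ω) [IsZeroOrProbabilityMeasure μ] (T : Ω → Ω)
    (S : (ι → ℤ) → Ω → Ω) (ξ : Ω → α) (n L : ℕ) :
    spaceTimeEntropyRate μ T S ξ ≤
      Ergodic.partitionEntropy μ (spaceTimeJoin T S ξ (n + 1) (L + 1)) /
        ((n + 1 : ℝ) * (L + 1 : ℝ) ^ Fintype.card ι) :=
  ciInf_le ⟨0, by
    rintro _ ⟨p, rfl⟩
    exact div_nonneg (Ergodic.partitionEntropy_nonneg _) (by positivity)⟩ (n, L)

/-- The **entropy of the space-time action** (per unit time per unit volume): `sup` of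
`spaceTimeEntropyRate` over finite measurable partitions (Keller 1998 Def. 3.2.11), in `[0, ∞]`
(same rendering of "all finite measurable partitions" as the tree's `kolmogorovSinaiEntropy`:
measurable `ξ : Ω → Fin k`, `k ∈ ℕ`). [cite: Keller1998, Def. 3.2.11] -/
def spaceTimeEntropy (μ : Measure Ω) (T : Ω → Ω) (S : (ι → ℤ) → Ω → Ω) : ℝ≥0∞ :=
  ⨆ (k : ℕ) (ξ : Ω → Fin k) (_ : Measurable ξ), ENNReal.ofReal (spaceTimeEntropyRate μ T S ξ)

/-- Each finite measurable `Fin k`-labelled partition bounds the space-time entropy from below.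
[folklore] -/
theorem ofReal_spaceTimeEntropyRate_le (μ : Measure Ω) (T : Ω → Ω) (S : (ι → ℤ) → Ω → Ω) {k : ℕ}
    {ξ : Ω → Fin k} (hξ : Measurable ξ) :
    ENNReal.ofReal (spaceTimeEntropyRate μ T S ξ) ≤ spaceTimeEntropy μ T S :=
  le_iSup_of_le k <| le_iSup_of_le ξ <| le_iSup_of_le hξ le_rfl

end Entropy

/-! ## 2. Lyapunov exponents of a linear cocycle and the sum of the positive ones -/

section Lyapunov

variable {V : Type*} [NormedAddCommGroup V] [NormedSpace ℝ V]

/-- The **forward (upper) Lyapunov exponent** of the vector `v` under the linear cocycle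
`A : ℕ → V →L[ℝ] V` (think `A n = D(f^n)(x)`): `χ(v) = limsup_n n⁻¹ log ‖A n v‖ ∈ [-∞, +∞]`, with
`log 0 = -∞` so that `χ(0) = -∞` (Barreira–Pesin 2023 §3.2, `χ⁺(x, v) = limsup m⁻¹ log ‖𝒜(x, m) v‖`).
Implemented as Mathlib's upper exponential growth `ExpGrowth.expGrowthSup` of `n ↦ ‖A n v‖ₑ`.
[cite: BarreiraPesin2023, §3.2 (definition of χ⁺)] -/
def lyapExponent (A : ℕ → V →L[ℝ] V) (v : V) : EReal :=
  ExpGrowth.expGrowthSup fun n => ‖A n v‖ₑ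

/-- Unfolding lemma for `lyapExponent`. [folklore] -/
theorem lyapExponent_def (A : ℕ → V →L[ℝ] V) (v : V) :
    lyapExponent A v = ExpGrowth.expGrowthSup fun n => ‖A n v‖ₑ :=
  rfl

/-- `χ(0) = -∞` (Barreira–Pesin 2023 §2.1.1, property (3) of an abstract Lyapunov exponent).
[cite: BarreiraPesin2023, §2.1.1 (3)] -/
@[simp]
theorem lyapExponent_zero (A : ℕ → V →L[ℝ] V) : lyapExponent A 0 = ⊥ := by
  have h : (fun n => ‖A n (0 : V)‖ₑ) = 0 := by
    funext n
    simp
  rw [lyapExponent, h, ExpGrowth.expGrowthSup_zero]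

/-- `χ(v + w) ≤ max (χ(v), χ(w))` (Barreira–Pesin 2023 §2.1.1, property (2) of an abstract Lyapunov
exponent; for the cocycle exponent: Exercise 3.9). [cite: BarreiraPesin2023, §2.1.1 (2) and Exercise 3.9] -/
theorem lyapExponent_add_le (A : ℕ → V →L[ℝ] V) (v w : V) :
    lyapExponent A (v + w) ≤ lyapExponent A v ⊔ lyapExponent A w := by
  rw [lyapExponent, lyapExponent, lyapExponent, ← ExpGrowth.expGrowthSup_add]
  exact ExpGrowth.expGrowthSup_monotone fun n => by
    simp only [Pi.add_apply, map_add]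
    exact enorm_add_le _ _

/-- `χ(a • v) ≤ χ(v)` for every scalar `a` (with equality for `a ≠ 0`: Barreira–Pesin 2023 §2.1.1,
property (1); Exercise 3.9 for cocycles). [cite: BarreiraPesin2023, §2.1.1 (1) and Exercise 3.9] -/
theorem lyapExponent_smul_le (A : ℕ → V →L[ℝ] V) (a : ℝ) (v : V) :
    lyapExponent A (a • v) ≤ lyapExponent A v := by
  refine ExpGrowth.expGrowthSup_le_of_eventually_le (b := ‖a‖ₑ) enorm_ne_top
    (Eventually.of_forall fun n => ?_)
  simp only [map_smul, enorm_smul, le_refl]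

/-- The **filtration subspace** `V_c = {v | χ(v) ≤ c}` of the Lyapunov exponent of the cocycle `A`
(Barreira–Pesin 2023 §2.1.2 (2.1) and §3.2 (1): `V_i⁺(x) = {v : χ⁺(x, v) ≤ χ_i⁺(x)}`); it is a linear
subspace because `χ(0) = -∞`, `χ(v + w) ≤ max` and `χ(a v) ≤ χ(v)`.
[cite: BarreiraPesin2023, §2.1.2 (2.1)] -/
def lyapFiltration (A : ℕ → V →L[ℝ] V) (c : EReal) : Submodule ℝ V where
  carrier := {v | lyapExponent A v ≤ c}
  zero_mem' := by simp
  add_mem' {v w} hv hw := (lyapExponent_add_le A v w).trans (sup_le hv hw)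
  smul_mem' a v hv := (lyapExponent_smul_le A a v).trans hv

/-- Membership in a filtration subspace. [folklore] -/
@[simp]
theorem mem_lyapFiltration (A : ℕ → V →L[ℝ] V) (c : EReal) (v : V) :
    v ∈ lyapFiltration A c ↔ lyapExponent A v ≤ c :=
  Iff.rfl

/-- The filtration is increasing in the level `c`. [folklore] -/
theorem lyapFiltration_mono (A : ℕ → V →L[ℝ] V) : Monotone (lyapFiltration A) :=
  fun _ _ h _ hv => le_trans hv h

/-- The **sum of the positive Lyapunov exponents counted with multiplicity**,
`∑_{i : χ_i > 0} k_i χ_i ∈ [0, ∞]`, `k_i = dim V_i - dim V_{i-1}` (Barreira–Pesin 2023 §2.1.2), written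
through the counting function of the spectrum as the layer-cake integral
`∫₀^∞ (dim V - dim V_c) dc` (`= ∑_j max(χ^{(j)}, 0)` for the exponents `χ^{(1)} ≥ ⋯ ≥ χ^{(dim V)}`
listed with multiplicity; `+∞` if some vector has exponent `+∞`). This is the integrand of the
Margulis–Ruelle inequality `h_ν(f) ≤ ∫ ∑_{χ_i(x)>0} k_i(x) χ_i(x) dν(x)` (Barreira–Pesin Thm. 9.22)
and of Pesin's entropy formula (Thm. 9.27). Intended for finite-dimensional `V` (`Module.finrank`
is `0` on infinite-dimensional spaces). [cite: BarreiraPesin2023, §2.1.2 and Thm. 9.22] -/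
def posLyapSum (A : ℕ → V →L[ℝ] V) : ℝ≥0∞ :=
  ∫⁻ c in Ioi (0 : ℝ), ((Module.finrank ℝ V - Module.finrank ℝ (lyapFiltration A c) : ℕ) : ℝ≥0∞)

/-- Unfolding lemma for `posLyapSum`. [folklore] -/
theorem posLyapSum_def (A : ℕ → V →L[ℝ] V) :
    posLyapSum A = ∫⁻ c in Ioi (0 : ℝ),
      ((Module.finrank ℝ V - Module.finrank ℝ (lyapFiltration A c) : ℕ) : ℝ≥0∞) :=
  rfl

/-- If no vector has a positive exponent, the sum of the positive exponents vanishes. [folklore] -/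
theorem posLyapSum_eq_zero (A : ℕ → V →L[ℝ] V)
    (h : ∀ v, lyapExponent A v ≤ 0) : posLyapSum A = 0 := by
  have htop : ∀ c : ℝ, 0 < c → lyapFiltration A c = ⊤ := fun c hc =>
    eq_top_iff.2 fun v _ => (h v).trans (by exact_mod_cast hc.le)
  have hzero : ∀ c ∈ Ioi (0 : ℝ),
      ((Module.finrank ℝ V - Module.finrank ℝ (lyapFiltration A c) : ℕ) : ℝ≥0∞) = 0 := by
    intro c hc
    rw [htop c hc, finrank_top, Nat.sub_self, Nat.cast_zero]
  rw [posLyapSum, setLIntegral_congr_fun measurableSet_Ioi hzero, lintegral_zero]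

end Lyapunov

/-! ## 3. Finite hard-sphere systems: tangent dynamics, entropy, Pesin defect -/

section HardSpheres

open Literature.Analysis.FluidPDE

variable {d : Type*} [Fintype d] {X : Type*} {N : ℕ}

/-- The tangent space of the `N`-particle phase space `Config N d X = (X × ℝ^d)^N` in the canonical
trivialisation by the geometry: infinitesimal displacements `(δxᵢ, δvᵢ)_{i<N} ∈ (ℝ^d × ℝ^d)^N` (with
the product sup-norm; Lyapunov exponents do not depend on the norm). [folklore] -/
abbrev TangentCfg (N : ℕ) (d : Type*) [Fintype d] : Type _ :=
  Fin N → EuclideanSpace ℝ d × EuclideanSpace ℝ d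

/-- The chart at `z`: displace particle `i` by `(δxᵢ, δvᵢ)` using the geometry's translation,
`(xᵢ + δxᵢ, vᵢ + δvᵢ)`. [folklore] -/
def perturb (G : Geometry d X) (z : Config N d X) (ξ : TangentCfg N d) : Config N d X :=
  fun i => (G.translate (z i).1 (ξ i).1, (z i).2 + (ξ i).2)

/-- The zero displacement does not move the configuration. [folklore] -/
@[simp]
theorem perturb_zero (G : Geometry d X) (z : Config N d X) : perturb G z 0 = z := by
  funext i
  simp [perturb]

/-- The inverse chart at `z`: the displacement `(sepVec xᵢ' xᵢ, vᵢ' - vᵢ)_i` of `z'` relative to `z`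
(minimal-image separation vector on the torus). [folklore] -/
def displacement (G : Geometry d X) (z z' : Config N d X) : TangentCfg N d :=
  fun i => (G.sepVec (z' i).1 (z i).1, (z' i).2 - (z i).2)

/-- A phase-space map `F` read in the charts at `z` and `F z`:
`ξ ↦ displacement (F z) (F (perturb z ξ))`. [folklore] -/
def inCharts (G : Geometry d X) (F : Config N d X → Config N d X) (z : Config N d X) :
    TangentCfg N d → TangentCfg N d :=
  fun ξ => displacement G (F z) (F (perturb G z ξ))

/-- The **derivative of a phase-space map `F` at `z` within the set `S`**, read in the charts:
`fderivWithin` at `0` of `inCharts G F z` within the chart preimage of `S` (junk value `0` where `F`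
is not differentiable within `S`). Taking the derivative WITHIN `S` makes it depend only on `F|_S`.
[folklore] -/
def tangentMapWithin (G : Geometry d X) (F : Config N d X → Config N d X) (S : Set (Config N d X))
    (z : Config N d X) : TangentCfg N d →L[ℝ] TangentCfg N d :=
  fderivWithin ℝ (inCharts G F z) (perturb G z ⁻¹' S) 0

variable [MeasureSpace X] [TopologicalSpace X] {G : Geometry d X} {ε : ℝ}

/-- The **derivative cocycle of a hard-sphere flow** at integer times: `D(Φ_n)(z)`, the derivative of
the time-`n` map at `z` read in the charts, within the good set `Φ.good` (on which `Φ_n` is the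
composition of the free flights `freeFlight` and elastic collisions `collidePair` met along the orbit,
`HardSphereFlow.isTrajectory`; off `Φ.good` the flow is unspecified, and `Φ.good` is Liouville-conull,
hence dense in every ball, so the derivative within it is unique). [folklore] -/
def tangentFlow (Φ : HardSphereFlow G ε N) (n : ℕ) (z : Config N d X) :
    TangentCfg N d →L[ℝ] TangentCfg N d :=
  tangentMapWithin G (Φ.flow n) Φ.good z

/-- The forward Lyapunov exponent `χ(z, v) = limsup_n n⁻¹ log ‖D(Φ_n)(z) v‖` of the tangent vector `v`
at `z` along the hard-sphere flow (exponent of the derivative cocycle of the time-one map,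
Barreira–Pesin 2023 §3.2). [cite: BarreiraPesin2023, §3.2 (definition of χ⁺)] -/
def flowLyapExponent (Φ : HardSphereFlow G ε N) (z : Config N d X) (v : TangentCfg N d) : EReal :=
  lyapExponent (fun n => tangentFlow Φ n z) v

/-- `∑λ⁺(z)`: the sum of the positive Lyapunov exponents, with multiplicity, of the orbit of `z` under
the hard-sphere flow (`posLyapSum` of its derivative cocycle). [cite: BarreiraPesin2023, Thm. 9.22 (integrand)] -/
def posLyapSumAt (Φ : HardSphereFlow G ε N) (z : Config N d X) : ℝ≥0∞ :=
  posLyapSum fun n => tangentFlow Φ n z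

/-- `∫ ∑λ⁺ dμ ∈ [0, ∞]`: the `μ`-average of the sum of the positive Lyapunov exponents (the right-hand
side of the Margulis–Ruelle inequality / Pesin formula for the time-one map, Barreira–Pesin 2023
Thm. 9.22, Thm. 9.27; lower Lebesgue integral, so no measurability is presupposed).
[cite: BarreiraPesin2023, Thm. 9.22 (right-hand side)] -/
def meanPosLyapSum (Φ : HardSphereFlow G ε N) (μ : Measure (Config N d X)) : ℝ≥0∞ :=
  ∫⁻ z, posLyapSumAt Φ z ∂μ

/-- `h_μ(Φ₁)`: the Kolmogorov–Sinai entropy (`Literature.Dynamics.Ergodic.kolmogorovSinaiEntropy`) of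
the time-one map of the hard-sphere flow with respect to the law `μ` (Walters 1982 Def. 4.10 applied
to `T = Φ.flow 1`). [cite: Walters1982, Def. 4.10] -/
def timeOneEntropy (Φ : HardSphereFlow G ε N) (μ : Measure (Config N d X)) : ℝ≥0∞ :=
  Ergodic.kolmogorovSinaiEntropy μ (Φ.flow 1)

/-- Unfolding lemma for `timeOneEntropy`. [folklore] -/
theorem timeOneEntropy_def (Φ : HardSphereFlow G ε N) (μ : Measure (Config N d X)) :
    timeOneEntropy Φ μ = Ergodic.kolmogorovSinaiEntropy μ (Φ.flow 1) :=
  rfl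

/-- The **Pesin defect** `∫ ∑λ⁺ dμ - h_μ(Φ₁) ∈ [0, ∞]` of a law `μ` for the hard-sphere flow `Φ`: the
amount by which `μ` fails Pesin's entropy formula `h = ∫ ∑λ⁺` (the measures with zero defect are those
"satisfying Pesin's entropy formula" of Ledrappier–Young 1985; the Margulis–Ruelle inequality,
Barreira–Pesin 2023 Thm. 9.22 for `C¹` diffeomorphisms, says the difference is `≥ 0`). Truncated
subtraction in `ℝ≥0∞`: the value is `0` if `∫ ∑λ⁺ dμ ≤ h_μ(Φ₁)` and if both are `∞`. [folklore] -/
def pesinDefect (Φ : HardSphereFlow G ε N) (μ : Measure (Config N d X)) : ℝ≥0∞ :=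
  meanPosLyapSum Φ μ - timeOneEntropy Φ μ

/-- Unfolding lemma for `pesinDefect`. [folklore] -/
theorem pesinDefect_def (Φ : HardSphereFlow G ε N) (μ : Measure (Config N d X)) :
    pesinDefect Φ μ = meanPosLyapSum Φ μ - timeOneEntropy Φ μ :=
  rfl

/-- A law whose entropy dominates `∫ ∑λ⁺` (so, under the Margulis–Ruelle inequality, a law satisfying
Pesin's formula) has zero defect. [folklore] -/
theorem pesinDefect_eq_zero_of_le {Φ : HardSphereFlow G ε N} {μ : Measure (Config N d X)}
    (h : meanPosLyapSum Φ μ ≤ timeOneEntropy Φ μ) : pesinDefect Φ μ = 0 :=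
  tsub_eq_zero_of_le h

/-- Under the Margulis–Ruelle inequality `h_μ(Φ₁) ≤ ∫ ∑λ⁺ dμ` the defect is the honest difference:
`h_μ(Φ₁) + defect = ∫ ∑λ⁺ dμ`. [folklore] -/
theorem timeOneEntropy_add_pesinDefect {Φ : HardSphereFlow G ε N} {μ : Measure (Config N d X)}
    (h : timeOneEntropy Φ μ ≤ meanPosLyapSum Φ μ) :
    timeOneEntropy Φ μ + pesinDefect Φ μ = meanPosLyapSum Φ μ :=
  add_tsub_cancel_of_le h

/-- The **Pesin defect per collision** at the Euler scaling of route `PesinPricing`: for `N` spheres of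
diameter `σ N^{-1/3}` on the unit torus `𝕋³` the number of collisions per unit macroscopic time is
`≍ N · N^{1/3} = N^{4/3}`, and the route prices behaviour by `i_N(μ) = (∫ ∑λ⁺ dμ - h_μ(Φ₁)) / N^{4/3}`
(for other dimensions / scalings divide `pesinDefect` by the appropriate collision count instead).
Junk value `x / 0` for `N = 0`. [folklore] -/
def pesinDefectPerCollision (Φ : HardSphereFlow G ε N) (μ : Measure (Config N d X)) : ℝ≥0∞ :=
  pesinDefect Φ μ / (N : ℝ≥0∞) ^ (4 / 3 : ℝ)

/-- Unfolding lemma for `pesinDefectPerCollision`. [folklore] -/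
theorem pesinDefectPerCollision_def (Φ : HardSphereFlow G ε N) (μ : Measure (Config N d X)) :
    pesinDefectPerCollision Φ μ = pesinDefect Φ μ / (N : ℝ≥0∞) ^ (4 / 3 : ℝ) :=
  rfl

end HardSpheres

/-! ## 4. The infinite hard-sphere gas: space-time entropy density and collision intensity -/

section Infinite

open Literature.Analysis.FluidPDE Literature.Analysis.FunctionSpaces

variable {d : Type*} [Fintype d] [DecidableEq d] {ε : ℝ}

/-- The spatial shift of a configuration of the infinite gas by the lattice vector `k ∈ ℤ^d`:
`ω ↦ ω + (k, 0)` (positions translated, velocities kept; the shifts of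
`IsTranslationInvariant` restricted to the unit lattice `Torus.latticeVec k`). [folklore] -/
def latticeShift (k : d → ℤ) :
    PointConfig (EuclideanSpace ℝ d × EuclideanSpace ℝ d) →
      PointConfig (EuclideanSpace ℝ d × EuclideanSpace ℝ d) :=
  PointConfig.translate ((Torus.latticeVec k, 0) : EuclideanSpace ℝ d × EuclideanSpace ℝ d)

/-- Lattice shifts are measurable (Kingman's mapping theorem, `PointConfig.measurable_translate`).
[folklore] -/
theorem measurable_latticeShift (k : d → ℤ) : Measurable (latticeShift (d := d) k) :=
  PointConfig.measurable_translate _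

/-- The **space-time entropy density** `h(ν) ∈ [0, ∞]` of a law `ν` on configurations of the infinite
hard-sphere gas evolving under the flow `Φ`: the entropy per unit time per unit volume of the
`ℤ^{1+d}`-action generated by the time-one map `Φ.flow 1` and the unit lattice translations
`latticeShift` — `sup` over finite measurable partitions `ξ` of `inf` over space-time boxes
`[0, n) × [0, L)^d` of `H_ν(⋁_{(m,k) ∈ box} (τ_k Φ_m)⁻¹ ξ) / (n L^d)` (Keller 1998 Thm. 3.2.4,
Def. 3.2.11). This is the entropy of the gas "with respect to the group of time-space translations"
of Chernov–Sinai (Trudy Sem. Petrovsk. 8 (1982) 218–238), whose identification with the thermodynamic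
limit of the Kolmogorov–Sinai entropy of finite systems, `lim h(Φ¹)/N = h(ρ, E)` as `Λ ↑ ℝ³`,
`N/|Λ| → ρ`, for small densities, is quoted in Wojtkowski 1988, p. 133. Intended for `ν` stationary
(`Φ.IsStationary ν`), translation invariant and a.e. good (`Φ.IsAEDefined ν`), where iterating
`Φ.flow 1` agrees a.e. with `Φ.flow n` (`InfiniteHardSphereFlow.flow_add_ae`).
[cite: Wojtkowski1988, p. 133 (Introduction)] -/
def entropyDensity (Φ : InfiniteHardSphereFlow d ε)
    (ν : Measure (PointConfig (EuclideanSpace ℝ d × EuclideanSpace ℝ d))) : ℝ≥0∞ :=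
  spaceTimeEntropy ν (Φ.flow 1) (latticeShift (d := d))

/-- Unfolding lemma for `entropyDensity`. [folklore] -/
theorem entropyDensity_def (Φ : InfiniteHardSphereFlow d ε)
    (ν : Measure (PointConfig (EuclideanSpace ℝ d × EuclideanSpace ℝ d))) :
    entropyDensity Φ ν = spaceTimeEntropy ν (Φ.flow 1) (latticeShift (d := d)) :=
  rfl

omit [DecidableEq d] in
/-- The **collision intensity** of the law `ν` under the flow `Φ`: the expected number of collision
events `(p, t)` (`collisionEvents`: particle `p` of `ω` touches another one at time `t`; each binary
collision is two events, one per partner) with `t ∈ [0, 1)` and position at the collision instant in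
the unit cube `[0,1)^d` — collisions per unit time per unit volume, in `[0, ∞]` (`Set.encard`, so
`∞` if infinitely many). Dividing by the `intensity` of `ν` gives the collision frequency per particle,
the clock of the route's "per particle per collision time" normalisation. [folklore] -/
def collisionIntensity (Φ : InfiniteHardSphereFlow d ε)
    (ν : Measure (PointConfig (EuclideanSpace ℝ d × EuclideanSpace ℝ d))) : ℝ≥0∞ :=
  ∫⁻ ω, ((collisionEvents ε (ω : Set (EuclideanSpace ℝ d × EuclideanSpace ℝ d)) (Φ.traj ω) ∩
      {e | e.2 ∈ Ico (0 : ℝ) 1 ∧ (Φ.traj ω e.1 e.2).1 ∈ Torus.unitCube d}).encard : ℝ≥0∞) ∂ν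

end Infinite

end Literature.Dynamics.Billiards

end
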